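import Summits.BirchSwinnertonDyer.BirchSwinnertonDyer.Theorems.AlignedTransportAtTwoMainConjectureTransportAlignedAtTwoDeltaPosFunctional
import HarnessLib

/-!
# Crux C1 `MainConjectureTransportAlignedAtTwo` (stmt-BirchSwinnertonDyer-22296), line `birth`, residual (R2) `stub_lamLawKilford` (Kilford stratum):
# (K2⁻) THE MOD-2 PLUS FUNCTIONAL ON THE RHOMBIC HALF-CELL `Δ(W) < 0` — for an odd Manin constant and the `2`-adic period unit, the integer plus value
# `n(x) = (2/Ω⁺_f)·re x(f)` of a cycle `x ∈ H₁(X₀(N);ℤ)` is EVEN iff `u_W(c·x(f)/2)` is `O` or `T* = u_W(iΩ₀'/2)` — the SAME statement as the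
# lead's (K2) for `Δ > 0` (`…DeltaPosFunctional`, p664803), now on rhombic lattices, where `u_W(iΩ₀'/2) = u_W(Ω₀/2)` is the unique real `2`-torsion
# point (width seat att-p3 g15; `--supports 22296`)

THEOREMS ONLY (no `def`, no `sorry`, no named fact). BSD is not proved by this; C1 is not closed by this; `stub_lamLawKilford` is NOT discharged by this.

Context. ON the Kilford stratum the `Δ < 0` pairs are the majority (396 of 533 cubic fields with ≥ 2 good-ordinary non-twist classes, D-imc-48
FIELDS48), and the lead's off-stratum `Δ < 0` road (`…TwoCurvePlusLine` / `…OrdPlusLine`: Buzzard's multiplicity one makes the plus line unique)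
has no analogue there (`J₀(N)[𝔪] ≅ ρ̄ ⊕ ρ̄`, Kilford–Wiese). The same-copy road (`…KilfordCopyTransport`, this seat) needs instead the functional
dictionary «`n̄(x) = e₂(T*, θ[x/2])`» on the `Δ < 0` half-cell. For a real lattice with `g₂³ − 27g₃² < 0` the Néron lattice is RHOMBIC:
`v := Ω₀/2 + iΩ₀'/2 ∈ Λ_E` (tree: `IsReal.discr_pos_of_halfPeriodI_add_notMem`, contrapositive), real parts of lattice points are HALF-integer
multiples of `Ω₀` (`IsReal.exists_re_eq_int_mul_half`), `Ω(W) = Ω₀` (one real component), and for `z ∈ Λ_E` with `2·re z = a·Ω₀`: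
`(z/2 ∈ Λ_E ∨ z/2 − w ∈ Λ_E) ↔ a` even, `w = iΩ₀'/2` (§1: `z − a'·2v` is purely imaginary, hence an integer multiple of `2w`). With the period unit
`Ω(W) = u·Ω⁺_f`, `‖u‖₂ = 1` and `c·n = a·u` (§2) this gives **`even_plusValue_iff_uniformize_half_of_Δ_neg`** (§2), literally the `Δ > 0` statement
with `0 < W.Δ` replaced by `W.Δ < 0`; and `u_W(w) = u_W(Ω₀/2)` (`halfPeriodI_sub_half_mem_of_Δ_neg`) is the real `2`-torsion point.

References: Cremona 1997 §2.8 (p. 26), §2.10 [CremonaAlgorithms1997]; Lawden 1989 §6.15–§6.17 (rhombic real lattices) [Lawden1989];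
Abbes–Ullmo 1996 Thm A [AbbesUllmo1996]; Greenberg–Vatsal 2000 §3 Rem. 3.4 [GreenbergVatsal2000].
-/

noncomputable section

-- justification: the `Summit.BirchSwinnertonDyer.BirchSwinnertonDyer.…` path repeats a component (route-file convention)
set_option linter.dupNamespace false
set_option autoImplicit false

open scoped ComplexConjugate ModularForm
open Complex Set PeriodPair CongruenceSubgroup
open Literature.NumberTheory.EllipticCurves Literature.NumberTheory.EllipticCurves.ModularForms
open Summit.BirchSwinnertonDyer.BirchSwinnertonDyer.Theorems.AlignedTransportAtTwoDeltaPosFunctional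

namespace Summit.BirchSwinnertonDyer.BirchSwinnertonDyer.Theorems.AlignedTransportAtTwoKilfordCopyNegDiscFunctional

/-! ## §1 Rhombic real lattices: `v = Ω₀/2 + iΩ₀'/2 ∈ Λ`, and the parity of the `Ω₀/2`-coordinate -/

section Lattice

variable {L : PeriodPair}

/-- **Purely imaginary lattice points of a real lattice are integer multiples of `iΩ₀' = 2w`.** [cite: Lawden1989, §6.15] -/
theorem exists_eq_int_mul_two_mul_halfPeriodI_of_re_eq_zero (h : L.IsReal) {y : ℂ} (hy : y ∈ L.lattice) (hre : y.re = 0) :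
    ∃ k : ℤ, y = (k : ℂ) * (2 * (I * (((L.mulLeft I I_ne_zero).minRealPeriod / 2 : ℝ) : ℂ))) := by
  have hyeq : y = I * ((y.im : ℝ) : ℂ) := by
    apply Complex.ext <;> simp [hre]
  have hy' : ((y.im : ℝ) : ℂ) ∈ (L.mulLeft I I_ne_zero).lattice := by
    rw [mem_mulLeft_lattice, Complex.inv_I]
    have := neg_mem hy
    rw [hyeq] at this
    convert this using 1
    ring
  obtain ⟨k, hk⟩ := h.mulLeft_I.exists_eq_int_mul hy'
  refine ⟨k, ?_⟩
  rw [hyeq, hk]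
  push_cast
  ring

/-- **Parity of the `Ω₀/2`-coordinate ↔ the half lies in `Λ ∪ (w + Λ)`, RHOMBIC case.** For a real lattice containing `v = iΩ₀'/2 + Ω₀/2` and
`z ∈ Λ` with `2·re z = a·Ω₀` (`a ∈ ℤ`): `(z/2 ∈ Λ ∨ z/2 − w ∈ Λ) ↔ Even a`, `w = iΩ₀'/2`. [cite: Lawden1989, §6.17] [cite: CremonaAlgorithms1997, §2.8] -/
theorem half_mem_or_sub_halfPeriodI_mem_iff_even_of_rhombic (h : L.IsReal)
    (hv : I * (((L.mulLeft I I_ne_zero).minRealPeriod / 2 : ℝ) : ℂ) + ((L.minRealPeriod / 2 : ℝ) : ℂ) ∈ L.lattice)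
    {z : ℂ} (hz : z ∈ L.lattice) {a : ℤ} (ha : 2 * z.re = a * L.minRealPeriod) :
    (z / 2 ∈ L.lattice ∨ z / 2 - I * ((((L.mulLeft I I_ne_zero).minRealPeriod / 2 : ℝ)) : ℂ) ∈ L.lattice) ↔ Even a := by
  set Ω₀ : ℝ := L.minRealPeriod with hΩ₀
  set w : ℂ := I * ((((L.mulLeft I I_ne_zero).minRealPeriod / 2 : ℝ)) : ℂ) with hw
  have hΩpos : 0 < Ω₀ := h.minRealPeriod_pos
  obtain ⟨h2w, -, -⟩ := h.two_mul_halfPeriodI_mem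
  have hwre : w.re = 0 := by simp [hw]
  -- real parts of lattice points are half-integer multiples of `Ω₀`
  have hre : ∀ y ∈ L.lattice, ∃ j : ℤ, 2 * y.re = j * Ω₀ := fun y hy ↦ by
    obtain ⟨j, hj⟩ := h.exists_re_eq_int_mul_half hy
    exact ⟨j, by rw [hj]; ring⟩
  constructor
  · -- `⇒`: `re(z/2) = aΩ₀/4` (resp. the same for `z/2 − w`) is a half-integer multiple of `Ω₀`
    rintro (hmem | hmem)
    · obtain ⟨j, hj⟩ := hre _ hmem
      have h1 : 2 * (z / 2).re = z.re := by rw [show (z / 2).re = z.re / 2 by simp]; ring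
      rw [h1] at hj
      have hcancel : (a : ℝ) = 2 * j := mul_right_cancel₀ hΩpos.ne' (by linarith : (a : ℝ) * Ω₀ = (2 * j) * Ω₀)
      exact ⟨j, by exact_mod_cast (by linarith : (a : ℝ) = j + j)⟩
    · obtain ⟨j, hj⟩ := hre _ hmem
      have h1 : 2 * (z / 2 - w).re = z.re := by rw [Complex.sub_re, hwre, show (z / 2).re = z.re / 2 by simp]; ring
      rw [h1] at hj
      have hcancel : (a : ℝ) = 2 * j := mul_right_cancel₀ hΩpos.ne' (by linarith : (a : ℝ) * Ω₀ = (2 * j) * Ω₀)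
      exact ⟨j, by exact_mod_cast (by linarith : (a : ℝ) = j + j)⟩
  · -- `⇐`: `a = 2a'`; `y := z − a'·(2v)` is purely imaginary, so `y = k·2w`, and `z/2 = a'v + kw`
    rintro ⟨a', rfl⟩
    set v : ℂ := w + ((Ω₀ / 2 : ℝ) : ℂ) with hv_def
    have hvmem : v ∈ L.lattice := hv
    set y : ℂ := z - (a' : ℂ) * (2 * v) with hy
    have hymem : y ∈ L.lattice := by
      have := L.lattice.smul_mem a' (L.lattice.smul_mem (2 : ℤ) hvmem)
      rw [zsmul_eq_mul, zsmul_eq_mul] at this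
      push_cast at this
      exact sub_mem hz this
    have hzre : z.re = a' * Ω₀ := by
      have : ((a' + a' : ℤ) : ℝ) = 2 * a' := by push_cast; ring
      rw [this] at ha; linarith
    have hyre : y.re = 0 := by
      rw [hy, Complex.sub_re, hzre, hv_def]
      simp [Complex.mul_re, hwre]
      ring
    obtain ⟨k, hk⟩ := exists_eq_int_mul_two_mul_halfPeriodI_of_re_eq_zero h hymem hyre
    have hz2 : z / 2 = (a' : ℂ) * v + (k : ℂ) * w := by
      have : z = y + (a' : ℂ) * (2 * v) := by rw [hy]; ring
      rw [this, hk]; ring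
    have hav : (a' : ℂ) * v ∈ L.lattice := by
      have := L.lattice.smul_mem a' hvmem
      rwa [zsmul_eq_mul] at this
    have h2wk : ∀ j : ℤ, (j : ℂ) * (2 * w) ∈ L.lattice := fun j ↦ by
      have := L.lattice.smul_mem j h2w
      rwa [zsmul_eq_mul] at this
    rcases Int.even_or_odd k with ⟨k', rfl⟩ | ⟨k', rfl⟩
    · left
      rw [hz2]
      have : ((k' + k' : ℤ) : ℂ) * w = (k' : ℂ) * (2 * w) := by push_cast; ring
      rw [this]
      exact add_mem hav (h2wk k')
    · right
      rw [hz2]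
      have : (a' : ℂ) * v + ((2 * k' + 1 : ℤ) : ℂ) * w - w = (a' : ℂ) * v + (k' : ℂ) * (2 * w) := by push_cast; ring
      rw [this]
      exact add_mem hav (h2wk k')

end Lattice

/-! ## §2 The curve: `Δ(W) < 0` makes the Néron lattice rhombic; the plus functional mod 2 is the pairing with `T*` -/

section Curve

variable {W : WeierstrassCurve ℚ} [W.IsElliptic] {N : ℕ} [NeZero N] (D : ModularParametrizationData W N)

omit [W.IsElliptic] in
/-- `disc(Λ_E)` is not positive for `Δ(W) < 0`, and it is non-zero. [folklore] -/
theorem not_discr_pos_of_Δ_neg (hΔ : W.Δ < 0) :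
    ¬ 0 < D.L.g₂.re ^ 3 - 27 * D.L.g₃.re ^ 2 ∧ D.L.g₂.re ^ 3 - 27 * D.L.g₃.re ^ 2 ≠ 0 := by
  rw [D.discr_neronLattice]
  have : (W.baseChange ℝ).Δ = (W.Δ : ℝ) := by
    simp only [WeierstrassCurve.baseChange, WeierstrassCurve.map_Δ, eq_ratCast]
  rw [this]
  have h : ((W.Δ : ℚ) : ℝ) < 0 := by exact_mod_cast hΔ
  exact ⟨not_lt.mpr h.le, h.ne⟩

omit [W.IsElliptic] in
/-- **`Δ(W) < 0` ⟹ the Néron lattice is RHOMBIC**: `v = iΩ₀'/2 + Ω₀/2 ∈ Λ_E`. [cite: Lawden1989, §6.16–§6.17] -/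
theorem halfPeriodI_add_half_mem_of_Δ_neg (hΔ : W.Δ < 0) :
    I * (((D.L.mulLeft I I_ne_zero).minRealPeriod / 2 : ℝ) : ℂ) + ((D.L.minRealPeriod / 2 : ℝ) : ℂ) ∈ D.L.lattice := by
  by_contra hnot
  obtain ⟨hnpos, hne⟩ := not_discr_pos_of_Δ_neg D hΔ
  exact hnpos (D.isReal_neronLattice.discr_pos_of_halfPeriodI_add_notMem hne hnot)

omit [W.IsElliptic] in
/-- **`u_W(iΩ₀'/2) = u_W(Ω₀/2)` on the rhombic half-cell**: `iΩ₀'/2 − Ω₀/2 ∈ Λ_E` for `Δ(W) < 0` (so the point `T* = u_W(iΩ₀'/2)` of the `Δ > 0`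
dictionary is, for `Δ < 0`, the real `2`-torsion point `u_W(Ω₀/2)`). [cite: Lawden1989, §6.17] -/
theorem halfPeriodI_sub_half_mem_of_Δ_neg (hΔ : W.Δ < 0) :
    I * (((D.L.mulLeft I I_ne_zero).minRealPeriod / 2 : ℝ) : ℂ) - ((D.L.minRealPeriod / 2 : ℝ) : ℂ) ∈ D.L.lattice := by
  have hv := halfPeriodI_add_half_mem_of_Δ_neg D hΔ
  have hΩ : ((D.L.minRealPeriod : ℝ) : ℂ) ∈ D.L.lattice := D.isReal_neronLattice.minRealPeriod_mem_lattice
  have : I * (((D.L.mulLeft I I_ne_zero).minRealPeriod / 2 : ℝ) : ℂ) - ((D.L.minRealPeriod / 2 : ℝ) : ℂ) =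
      (I * (((D.L.mulLeft I I_ne_zero).minRealPeriod / 2 : ℝ) : ℂ) + ((D.L.minRealPeriod / 2 : ℝ) : ℂ)) -
        ((D.L.minRealPeriod : ℝ) : ℂ) := by
    push_cast; ring
  rw [this]
  exact sub_mem hv hΩ

/-- `Ω(W) = Ω₀` for `Δ(W) < 0` (one real component). [cite: CremonaAlgorithms1997, §2.8 (p. 26), §3.7] -/
theorem realPeriodRat_eq_of_Δ_neg (hΔ : W.Δ < 0) : W.realPeriodRat = D.L.minRealPeriod := by
  rw [D.realPeriodRat_eq_numRealComponents_mul]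
  have hΔ' : (W.baseChange ℝ).Δ ≤ 0 := by
    have : (W.baseChange ℝ).Δ = (W.Δ : ℝ) := by
      simp only [WeierstrassCurve.baseChange, WeierstrassCurve.map_Δ, eq_ratCast]
    rw [this]; exact_mod_cast hΔ.le
  rw [(W.baseChange ℝ).numRealComponents_of_Δ_nonpos hΔ']
  norm_num

/-- **(K2⁻) The mod-2 plus functional is the pairing with `T*` (lattice form), `Δ(W) < 0`.** `D` a parametrisation datum of `W` with ODD Manin constant
`c`; `Ω(W) = u·Ω⁺_f` with `‖u‖₂ = 1` (the period unit at `2`); `x ∈ H₁(X₀(N);ℤ)` with integer plus value `n`, `n·Ω⁺_f = 2·re x(f)`. Then `n` is even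
iff `c·x(f)/2 ∈ Λ_E` or `c·x(f)/2 − w ∈ Λ_E`, `w = iΩ₀'/2`. [cite: CremonaAlgorithms1997, §2.8 (p. 26), §2.10] [cite: AbbesUllmo1996, Thm. A] -/
theorem even_plusValue_iff_half_mem_or_sub_halfPeriodI_mem_of_Δ_neg (hΔ : W.Δ < 0) (hc : Odd D.c) {u : ℚ}
    (hu : ‖(u : ℚ_[2])‖ = 1) (hΩ : W.realPeriodRat = u * plusPeriod D.f)
    {x : Module.Dual ℂ (CuspForm (Gamma0 N) 2)} (hx : x ∈ periodHomology N)
    {n : ℤ} (hn : (n : ℝ) * plusPeriod D.f = 2 * (x D.f).re) :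
    Even n ↔ ((D.c : ℂ) * x D.f / 2 ∈ D.L.lattice ∨
      (D.c : ℂ) * x D.f / 2 - I * ((((D.L.mulLeft I I_ne_zero).minRealPeriod / 2 : ℝ)) : ℂ) ∈ D.L.lattice) := by
  have hreal := D.isReal_neronLattice
  have hΩpos : 0 < D.L.minRealPeriod := hreal.minRealPeriod_pos
  have hzmem := maninConstant_mul_eval_mem D hx
  -- the half-integer `Ω₀`-coordinate `a` of `re (c·x(f))`
  obtain ⟨a, ha⟩ := hreal.exists_re_eq_int_mul_half hzmem
  have ha' : 2 * ((D.c : ℂ) * x D.f).re = a * D.L.minRealPeriod := by rw [ha]; ring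
  rw [half_mem_or_sub_halfPeriodI_mem_iff_even_of_rhombic hreal (halfPeriodI_add_half_mem_of_Δ_neg D hΔ) hzmem ha']
  -- it remains: `Even n ↔ Even a`, from `a·u = c·n`
  have hre' : ((D.c : ℂ) * x D.f).re = D.c * (x D.f).re := by simp [Complex.mul_re]
  have hu0 : u ≠ 0 := by
    rintro rfl; simp at hu
  have h1 : W.realPeriodRat = D.L.minRealPeriod := realPeriodRat_eq_of_Δ_neg D hΔ
  have hplus' : plusPeriod D.f * u = D.L.minRealPeriod := by
    have hu0' : (u : ℝ) ≠ 0 := by exact_mod_cast hu0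
    rw [← h1, hΩ]; field_simp
  have key : (a : ℝ) * u = D.c * n := by
    -- `aΩ₀ = 2c·re x(f) = c·n·Ω⁺_f`, and `Ω⁺_f·u = Ω₀`
    have h2 : (a : ℝ) * D.L.minRealPeriod = D.c * (n * plusPeriod D.f) := by
      rw [hn, ← ha', hre']; ring
    have h3 : D.L.minRealPeriod * ((a : ℝ) * u - D.c * n) = 0 := by
      linear_combination (u : ℝ) * h2 + (D.c : ℝ) * (n : ℝ) * hplus'
    rcases mul_eq_zero.mp h3 with h0 | h0
    · exact absurd h0 hΩpos.ne'
    · linarith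
  have key' : (a : ℚ) * u = D.c * n := by exact_mod_cast key
  exact (even_iff_even_of_mul_unit_eq_odd_mul hu hc key').symm

/-- **(K2⁻) point form.** Same hypotheses; with `u_W = D.uniformize` (kernel `Λ_E`): `n` is even iff `u_W(c·x(f)/2) = O` or `u_W(c·x(f)/2) = u_W(w)`,
`w = iΩ₀'/2` — the statement of the lead's `Δ > 0` theorem `…DeltaPosFunctional.even_plusValue_iff_uniformize_half` VERBATIM with `0 < W.Δ` replaced by
`W.Δ < 0`; here `u_W(w) = u_W(Ω₀/2)` is the unique real `2`-torsion point. By `jacobiMap_mk` the left point is `D.jacobiMap [x/2]`.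
[cite: CremonaAlgorithms1997, §2.8, §2.10] [cite: AbbesUllmo1996, Thm. A] -/
theorem even_plusValue_iff_uniformize_half_of_Δ_neg (hΔ : W.Δ < 0) (hc : Odd D.c) {u : ℚ} (hu : ‖(u : ℚ_[2])‖ = 1)
    (hΩ : W.realPeriodRat = u * plusPeriod D.f) {x : Module.Dual ℂ (CuspForm (Gamma0 N) 2)} (hx : x ∈ periodHomology N)
    {n : ℤ} (hn : (n : ℝ) * plusPeriod D.f = 2 * (x D.f).re) :
    Even n ↔ (D.uniformize ((D.c : ℂ) * x D.f / 2) = 0 ∨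
      D.uniformize ((D.c : ℂ) * x D.f / 2) = D.uniformize (I * ((((D.L.mulLeft I I_ne_zero).minRealPeriod / 2 : ℝ)) : ℂ))) := by
  rw [even_plusValue_iff_half_mem_or_sub_halfPeriodI_mem_of_Δ_neg D hΔ hc hu hΩ hx hn]
  have hker : ∀ z : ℂ, D.uniformize z = 0 ↔ z ∈ D.L.lattice := fun z ↦ by
    rw [← SetLike.mem_coe, ← D.ker_uniformize, SetLike.mem_coe, AddMonoidHom.mem_ker]
  rw [hker, ← sub_eq_zero (a := D.uniformize _), ← map_sub, hker]

/-- **(K2) for either sign of `Δ`.** The two dictionaries assembled: for `Δ(W) ≠ 0` read as `0 < W.Δ ∨ W.Δ < 0`. [cite: CremonaAlgorithms1997, §2.8, §2.10] -/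
theorem even_plusValue_iff_uniformize_half_of_Δ_pos_or_neg (hΔ : 0 < W.Δ ∨ W.Δ < 0) (hc : Odd D.c) {u : ℚ} (hu : ‖(u : ℚ_[2])‖ = 1)
    (hΩ : W.realPeriodRat = u * plusPeriod D.f) {x : Module.Dual ℂ (CuspForm (Gamma0 N) 2)} (hx : x ∈ periodHomology N)
    {n : ℤ} (hn : (n : ℝ) * plusPeriod D.f = 2 * (x D.f).re) :
    Even n ↔ (D.uniformize ((D.c : ℂ) * x D.f / 2) = 0 ∨
      D.uniformize ((D.c : ℂ) * x D.f / 2) = D.uniformize (I * ((((D.L.mulLeft I I_ne_zero).minRealPeriod / 2 : ℝ)) : ℂ))) := by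
  rcases hΔ with hΔ | hΔ
  · exact even_plusValue_iff_uniformize_half D hΔ hc hu hΩ hx hn
  · exact even_plusValue_iff_uniformize_half_of_Δ_neg D hΔ hc hu hΩ hx hn

end Curve

end Summit.BirchSwinnertonDyer.BirchSwinnertonDyer.Theorems.AlignedTransportAtTwoKilfordCopyNegDiscFunctional

end
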